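import Mathlib.GroupTheory.MonoidLocalization.UniqueFactorization
import Mathlib.AlgebraicGeometry.Noetherian
import Literature.AlgebraicGeometry.Motives.AffineSpaceCharts
import HarnessLib

/-!
# The local rings of `𝔸ⁿ_X` are factorial when those of `X` are

For an integral scheme `X` all of whose local rings `𝒪_{X,x}` are factorial, all local rings of
`𝔸ⁿ_X` are factorial (`uniqueFactorizationMonoid_stalk_affineSpace`): the local ring at a point
`z = chart 𝔓` over `x ∈ U = Spec B` is `B[t]_𝔓`, a localisation of the factorial
`𝒪_{X,x}[t]` (Gauss: polynomial rings over factorial rings are factorial, Mathlib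
`MvPolynomial.uniqueFactorizationMonoid`; localisations of factorial rings are factorial,
Mathlib `UniqueFactorizationMonoid.of_isLocalization`; the dictionary of
`Motives/AffineSpaceCharts`). Also: `𝔸ⁿ_X` is locally noetherian when `X` is
(`isLocallyNoetherian_affineSpace`, `n` finite). Everything is proved; no named facts.

Mathlib searched (pin v4.32.0) and used: `UniqueFactorizationMonoid.of_isLocalization`,
`MulEquiv.uniqueFactorizationMonoid`, `IsLocalization.isLocalization_of_submonoid_le`,
`IsLocalization.lift`, `Spec.stalkIso`, `Scheme.Hom.stalkMap` (an isomorphism for open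
immersions), `LocallyOfFiniteType.isLocallyNoetherian`.

## References

* U. Görtz, T. Wedhorn, *Algebraic Geometry I: Schemes*, 2nd ed. (2020): Prop. B.75 and
  Prop. B.73 (factorial rings; Gauss), (2.10.2). [GortzWedhorn2020]
-/

universe u

open CategoryTheory AlgebraicGeometry TopologicalSpace
open Literature.AlgebraicGeometry.Motives.AffineSpaceChart

noncomputable section

namespace Literature.AlgebraicGeometry.Motives

namespace AffineSpaceChart

attribute [local instance] MvPolynomial.algebraMvPolynomial

variable {X : Scheme.{u}} [IsIntegral X] (U : X.affineOpens) [Nonempty (U : X.Opens)] (n : Type u)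
  {x : (U : X.Opens)}

/-- **`B[t]_𝔓` is a localisation of `𝒪_{X,x}[t]`** for `chart 𝔓` over `x`, hence factorial when
`𝒪_{X,x}` is. [folklore] -/
theorem uniqueFactorizationMonoid_localization_of_over_eq
    [UniqueFactorizationMonoid (X.presheaf.stalk (x : X))] {𝔓 : PrimeSpectrum (polyRing U n)}
    (h𝔓 : (𝔸(n; X) ↘ X) (chart U n 𝔓) = x) :
    UniqueFactorizationMonoid (Localization.AtPrime 𝔓.asIdeal) := by
  -- `𝒪_{X,x}[t] → B[t]_𝔓`
  let M : Submonoid (MvPolynomial n Γ(X, U)) :=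
    (U.2.primeIdealOf x).asIdeal.primeCompl.map (MvPolynomial.C : Γ(X, U) →+* MvPolynomial n Γ(X, U))
  have hMN : M ≤ 𝔓.asIdeal.primeCompl := by
    intro m hm hm𝔓
    exact Set.disjoint_left.1 (disjoint_of_over_eq U n h𝔓) hm hm𝔓
  have hunits : ∀ m : M, IsUnit (algebraMap (polyRing U n) (Localization.AtPrime 𝔓.asIdeal) m) :=
    fun m => IsLocalization.map_units (Localization.AtPrime 𝔓.asIdeal) ⟨m.1, hMN m.2⟩
  letI : Algebra (stalkPoly U n x) (Localization.AtPrime 𝔓.asIdeal) :=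
    (IsLocalization.lift (M := M) (S := stalkPoly U n x) hunits).toAlgebra
  haveI : IsScalarTower (polyRing U n) (stalkPoly U n x) (Localization.AtPrime 𝔓.asIdeal) :=
    IsScalarTower.of_algebraMap_eq fun p => by
      change _ = IsLocalization.lift hunits (algebraMap (polyRing U n) (stalkPoly U n x) p)
      rw [IsLocalization.lift_eq]
  haveI : IsLocalization (𝔓.asIdeal.primeCompl.map (algebraMap (polyRing U n) (stalkPoly U n x)))
      (Localization.AtPrime 𝔓.asIdeal) :=
    IsLocalization.isLocalization_of_submonoid_le (stalkPoly U n x) (Localization.AtPrime 𝔓.asIdeal)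
      M 𝔓.asIdeal.primeCompl hMN
  exact UniqueFactorizationMonoid.of_isLocalization
    (𝔓.asIdeal.primeCompl.map (algebraMap (polyRing U n) (stalkPoly U n x)))
    (Localization.AtPrime 𝔓.asIdeal)

end AffineSpaceChart

/-- **The local rings of `𝔸ⁿ_X` are factorial when those of `X` are** (Gauss' lemma and
localisation, through the charts `Spec B[t] → 𝔸ⁿ_X`). [cite: GortzWedhorn2020, Prop. B.75 and Prop. B.73 (3)] -/
theorem uniqueFactorizationMonoid_stalk_affineSpace {X : Scheme.{u}} [IsIntegral X] (n : Type u)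
    (hUFD : ∀ x : X, UniqueFactorizationMonoid (X.presheaf.stalk x)) (z : 𝔸(n; X)) :
    UniqueFactorizationMonoid ((𝔸(n; X)).presheaf.stalk z) := by
  obtain ⟨U', hU', hzU', -⟩ := exists_isAffineOpen_mem_and_subset
    (show (𝔸(n; X) ↘ X) z ∈ (⊤ : X.Opens) from trivial)
  obtain ⟨U, hzU⟩ : ∃ U : X.affineOpens, (𝔸(n; X) ↘ X) z ∈ (U : X.Opens) := ⟨⟨U', hU'⟩, hzU'⟩
  haveI : Nonempty (U : X.Opens) := ⟨⟨_, hzU⟩⟩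
  obtain ⟨x, hx⟩ : ∃ x : (U : X.Opens), (x : X) = (𝔸(n; X) ↘ X) z := ⟨⟨_, hzU⟩, rfl⟩
  haveI := hUFD (x : X)
  obtain ⟨𝔓, rfl⟩ := exists_chart_eq U n z hzU
  have h𝔓 : (𝔸(n; X) ↘ X) (chart U n 𝔓) = x := hx.symm
  have h1 := AffineSpaceChart.uniqueFactorizationMonoid_localization_of_over_eq U n h𝔓
  -- transport along `𝒪_{𝔸ⁿ_X, chart 𝔓} ≅ 𝒪_{Spec B[t], 𝔓} ≅ B[t]_𝔓`
  haveI : IsIso ((chart U n).stalkMap 𝔓) := inferInstance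
  let e₁ := (asIso ((chart U n).stalkMap 𝔓)).commRingCatIsoToRingEquiv
  let e₂ := (Spec.stalkIso (polyRing U n) 𝔓).commRingCatIsoToRingEquiv
  exact (e₁.trans e₂).symm.toMulEquiv.uniqueFactorizationMonoid h1

/-- `𝔸ⁿ_X` is locally noetherian when `X` is (`n` finite). [folklore] -/
theorem isLocallyNoetherian_affineSpace {X : Scheme.{u}} (n : Type u) [Finite n]
    [IsLocallyNoetherian X] : IsLocallyNoetherian 𝔸(n; X) :=
  LocallyOfFiniteType.isLocallyNoetherian (𝔸(n; X) ↘ X)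

end Literature.AlgebraicGeometry.Motives

end
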